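import Summits.QuantumFields.YangMills.Theorems.UnitScaleTiltProp7PowerSeriesSecondDiff
import Literature.Analysis.Calculus.ExpDifferentialAdSeries
import HarnessLib

/-!
# Prop 7, route-R E′, (E1-c) brick F3b(i) — SECOND DIFFERENCES OF A POWER SERIES WITH FACTORIALLY BOUNDED COEFFICIENTS, AND OF BAŁABAN's `g(T) = Σ (−T)ⁿ∕(n+1)!`

Route `UnitScaleTilt`, crux K1 child «MinimiserStabilityRegPr» (`stmt-QuantumFields-19200`), cell ym3-torus, width seat px15 (gen 2); pen «px15 g2: (E1-c) GO-LOCATE» (★p1 g15,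
2026-08-28T20:45:05Z), LOCATE `LOCATE-E1C-DIVLIPSCHITZ-px15g2.md` §3∕§6 (F3b).  THEOREMS ONLY (0 `def`, 0 `sorry`); `--supports stmt-QuantumFields-19200`, count-neutral.
YM₃ on T³ is a ladder rung (R3), not the Clay problem; nothing here claims the stub, the crux, d = 4 or the mass gap.

WHY.  The pure-gauge piece of the chart remainder is resummed against `Δ_Wψ` through the site coefficient `1 + M_λ = g(ad(iλ))`, `g(T) = Σ_{n≥0}(−T)ⁿ∕(n+1)!` ([Balaban1985Averaging] (32)–(33);
tree ✓ `Literature.Analysis.Calculus.ExpDifferential.gSer`, `dexp_apply`).  F1's product rule needs, beyond the size row ✓ `norm_gSer_sub_one_le`, a LIPSCHITZ row of `λ ↦ M_λ` and, on the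
ψ-difference, a SECOND-DIFFERENCE row.  Both follow from ONE generic statement — the four-point row of ✓ `Prop7PowerSeriesSecondDiff.norm_exp_secondDiff_le` holds verbatim for every power series
`f(x) = Σ cₙ•xⁿ` with `‖cₙ‖ ≤ 1∕n!` — applied in the operator algebra `𝔄 →L[ℂ] 𝔄` to `g` (coefficients `1∕(n+1)! ≤ 1∕n!`, variable `−T`); the Lipschitz row is its `a′ = b′` case.

WHAT IS PROVED (def-free; `E` any complete normed `ℂ`-algebra; ns `…Theorems.Prop7GSerSecondDiff`).
* ★★ `norm_series_secondDiff_le` — for `c : ℕ → ℂ` with `‖c n‖ ≤ (n!)⁻¹` and `‖a‖, ‖b‖, ‖a′‖, ‖b′‖ ≤ R`: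
  `‖(Σcₙaⁿ − Σcₙbⁿ) − (Σcₙa′ⁿ − Σcₙb′ⁿ)‖ ≤ e^R·(‖(a−b) − (a′−b′)‖ + ‖a′ − b′‖(‖a − a′‖ + ‖b − b′‖))`; `norm_series_sub_series_le` (its `a′ = b′` case: `e^R`-Lipschitz).
* ★★ `norm_gSer_secondDiff_le`, ★ `norm_gSer_sub_gSer_le` (`‖g(T) − g(T′)‖ ≤ e^R‖T − T′‖`) for `g = gSer ℂ`; `norm_ad_sub_ad_le` (`‖ad X − ad Y‖ ≤ 2‖X − Y‖`, from ✓ `norm_ad_le`).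
HONEST SCOPE.  Elementary ([folklore]).

References: T. Bałaban, CMP 98 (1985) 17–51 [Balaban1985Averaging] ((32)–(34) p.22); B. C. Hall, *Lie Groups, Lie Algebras, and Representations*, 2nd ed. (2015), Thm. 5.4 [Hall2015].
-/

set_option autoImplicit false

noncomputable section

open NormedSpace
open scoped Nat

namespace Summit.QuantumFields.YangMills.Theorems.Prop7GSerSecondDiff

open Literature.Analysis.Calculus.ExpDifferential (gSer ad hasSum_gSer norm_ad_le ad_smul)
open Summit.QuantumFields.YangMills.Theorems.Prop7PowerSeriesSecondDiff (norm_pow_secondDiff_le)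

variable {E : Type*} [NormedRing E] [NormedAlgebra ℂ E] [CompleteSpace E]

/-- The real exponential series `Σ Rⁿ∕n! = e^R` (bookkeeping). [folklore] -/
theorem hasSum_pow_div_factorial (R : ℝ) : HasSum (fun n : ℕ => R ^ n / n !) (Real.exp R) := by
  have h := exp_series_hasSum_exp' (𝕂 := ℝ) R
  rw [← Real.exp_eq_exp_ℝ] at h
  simpa [smul_eq_mul, div_eq_inv_mul] using h

omit [CompleteSpace E] in
/-- Factorially bounded coefficients make `Σ cₙ•xⁿ` absolutely convergent everywhere. [folklore] -/
theorem summable_series {c : ℕ → ℂ} (hc : ∀ n, ‖c n‖ ≤ (n ! : ℝ)⁻¹) (x : E) : Summable fun n : ℕ => ‖c n • x ^ n‖ := by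
  refine Summable.of_nonneg_of_le (fun _ => norm_nonneg _) (fun n => ?_) (norm_expSeries_summable' (𝕂 := ℂ) x)
  rw [norm_smul, norm_smul]
  refine mul_le_mul_of_nonneg_right ?_ (norm_nonneg _)
  rw [norm_inv, Complex.norm_natCast]
  exact hc n

/-- ★★ **SECOND DIFFERENCE OF A FACTORIALLY DOMINATED POWER SERIES**: `‖c n‖ ≤ 1∕n!`, `‖a‖, ‖b‖, ‖a′‖, ‖b′‖ ≤ R` ⇒
`‖(Σcₙ•aⁿ − Σcₙ•bⁿ) − (Σcₙ•a′ⁿ − Σcₙ•b′ⁿ)‖ ≤ e^R·(‖(a−b) − (a′−b′)‖ + ‖a′ − b′‖·(‖a − a′‖ + ‖b − b′‖))`. [folklore] [cite: Balaban1985Averaging, (32)-(33) p.22] -/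
theorem norm_series_secondDiff_le {c : ℕ → ℂ} (hc : ∀ n, ‖c n‖ ≤ (n ! : ℝ)⁻¹) {a b a' b' : E} {R : ℝ}
    (ha : ‖a‖ ≤ R) (hb : ‖b‖ ≤ R) (ha' : ‖a'‖ ≤ R) (hb' : ‖b'‖ ≤ R) :
    ‖((∑' n : ℕ, c n • a ^ n) - ∑' n : ℕ, c n • b ^ n) - ((∑' n : ℕ, c n • a' ^ n) - ∑' n : ℕ, c n • b' ^ n)‖
      ≤ Real.exp R * (‖(a - b) - (a' - b')‖ + ‖a' - b'‖ * (‖a - a'‖ + ‖b - b'‖)) := by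
  have hR : 0 ≤ R := (norm_nonneg a).trans ha
  set E₀ := ‖(a - b) - (a' - b')‖ with hE
  set D := ‖a' - b'‖ with hD
  set S := ‖a - a'‖ + ‖b - b'‖ with hS
  have hE0 : 0 ≤ E₀ := norm_nonneg _
  have hD0 : 0 ≤ D := norm_nonneg _
  have hS0 : 0 ≤ S := by positivity
  have hs : ∀ x : E, HasSum (fun n : ℕ => c n • x ^ n) (∑' n : ℕ, c n • x ^ n) := fun x => (summable_series hc x).of_norm.hasSum
  have hsum := ((hs a).sub (hs b)).sub ((hs a').sub (hs b'))
  rw [← hsum.tsum_eq]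
  set q : ℕ → ℝ := fun n => Nat.casesOn n 0 fun m => Nat.casesOn m E₀ fun k => R ^ (k + 1) / (k + 1)! * E₀ + R ^ k / k ! * (D * S) with hq
  have hreal := hasSum_pow_div_factorial R
  have hE_part : HasSum (fun n : ℕ => Nat.casesOn n (0 : ℝ) fun m => R ^ m / m ! * E₀) (Real.exp R * E₀) := by
    have h1 : HasSum (fun m : ℕ => R ^ m / m ! * E₀) (Real.exp R * E₀) := hreal.mul_right E₀
    refine (hasSum_nat_add_iff' 1).1 ?_
    simpa using h1
  have hDS_part : HasSum (fun n : ℕ => Nat.casesOn n (0 : ℝ) fun m => Nat.casesOn m (0 : ℝ) fun k => R ^ k / k ! * (D * S)) (Real.exp R * (D * S)) := by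
    have h1 : HasSum (fun k : ℕ => R ^ k / k ! * (D * S)) (Real.exp R * (D * S)) := hreal.mul_right (D * S)
    refine (hasSum_nat_add_iff' 2).1 ?_
    simpa [Finset.sum_range_succ] using h1
  have hqsum : HasSum q (Real.exp R * (E₀ + D * S)) := by
    have h := hE_part.add hDS_part
    have heq : (fun n : ℕ => (Nat.casesOn n (0 : ℝ) fun m => R ^ m / m ! * E₀)
        + (Nat.casesOn n (0 : ℝ) fun m => Nat.casesOn m (0 : ℝ) fun k => R ^ k / k ! * (D * S))) = q := by
      funext n
      rcases n with _ | m
      · simp [hq]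
      · rcases m with _ | k
        · simp [hq]
        · simp only [hq]
    rw [heq] at h
    convert h using 1
    ring
  refine tsum_of_norm_bounded hqsum fun n => ?_
  rcases n with _ | m
  · simp [hq]
  · rcases m with _ | k
    · -- n = 1
      simp only [hq, zero_add, pow_one]
      rw [← smul_sub, ← smul_sub, ← smul_sub, norm_smul]
      have h1 : ‖c 1‖ ≤ 1 := by simpa using hc 1
      calc ‖c 1‖ * ‖(a - b) - (a' - b')‖ ≤ 1 * ‖(a - b) - (a' - b')‖ := mul_le_mul_of_nonneg_right h1 (norm_nonneg _)
        _ = E₀ := one_mul _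
    · -- n = k + 2
      simp only [hq]
      rw [← smul_sub, ← smul_sub, ← smul_sub, norm_smul]
      have hpow := norm_pow_secondDiff_le ha hb ha' hb' k
      have hck : ‖c (k + 2)‖ ≤ ((k + 2)! : ℝ)⁻¹ := hc (k + 2)
      have hfac : ((k + 2)! : ℝ) = (k + 2) * ((k + 1) * k !) := by push_cast [Nat.factorial_succ]; ring
      have hfac1 : ((k + 1)! : ℝ) = (k + 1) * k ! := by push_cast [Nat.factorial_succ]; ring
      have hk0 : (0 : ℝ) < k ! := by positivity
      have hpos : (0 : ℝ) < (k + 2) * ((k + 1) * k !) := by positivity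
      have h0 : 0 ≤ ‖(a ^ (k + 2) - b ^ (k + 2)) - (a' ^ (k + 2) - b' ^ (k + 2))‖ := norm_nonneg _
      calc ‖c (k + 2)‖ * ‖(a ^ (k + 2) - b ^ (k + 2)) - (a' ^ (k + 2) - b' ^ (k + 2))‖
          ≤ ((k + 2)! : ℝ)⁻¹ * ((k + 2) * R ^ (k + 1) * E₀ + (k + 2) * (k + 1) * R ^ k * D * S) :=
            mul_le_mul hck hpow h0 (by positivity)
        _ = R ^ (k + 1) / (k + 1)! * E₀ + R ^ k / k ! * (D * S) := by
            rw [hfac, hfac1]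
            field_simp

/-- `e^R`-Lipschitz: `‖Σcₙ•aⁿ − Σcₙ•bⁿ‖ ≤ e^R‖a − b‖` (the `a′ = b′` case). [folklore] -/
theorem norm_series_sub_series_le {c : ℕ → ℂ} (hc : ∀ n, ‖c n‖ ≤ (n ! : ℝ)⁻¹) {a b : E} {R : ℝ} (ha : ‖a‖ ≤ R) (hb : ‖b‖ ≤ R) :
    ‖(∑' n : ℕ, c n • a ^ n) - ∑' n : ℕ, c n • b ^ n‖ ≤ Real.exp R * ‖a - b‖ := by
  have h := norm_series_secondDiff_le hc ha hb hb hb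
  simp only [sub_self, sub_zero, norm_zero, zero_mul, add_zero] at h
  exact h

/-! ## The `g`-series and `ad` -/

/-- `g(T) = Σ cₙ•(−T)ⁿ` with `cₙ = 1∕(n+1)!`, `‖cₙ‖ ≤ 1∕n!`. (bookkeeping) [cite: Balaban1985Averaging, (33) p.22] -/
theorem gSer_eq_tsum (T : E) : gSer ℂ T = ∑' n : ℕ, (((n + 1)! : ℂ)⁻¹) • (-T) ^ n :=
  ((hasSum_gSer (𝕂 := ℂ) T).tsum_eq).symm

/-- `‖((n+1)!⁻¹ : ℂ)‖ ≤ (n!)⁻¹`. (bookkeeping) [folklore] -/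
theorem norm_inv_factorial_succ_le (n : ℕ) : ‖(((n + 1)! : ℂ)⁻¹)‖ ≤ (n ! : ℝ)⁻¹ := by
  rw [norm_inv, Complex.norm_natCast]
  exact inv_anti₀ (by positivity) (by exact_mod_cast Nat.factorial_le (Nat.le_succ n))

/-- ★★ **SECOND DIFFERENCE OF `g`**: for `‖a‖, ‖b‖, ‖a′‖, ‖b′‖ ≤ R`, `‖(g a − g b) − (g a′ − g b′)‖ ≤ e^R·(‖(a−b) − (a′−b′)‖ + ‖a′ − b′‖(‖a − a′‖ + ‖b − b′‖))`.
[cite: Balaban1985Averaging, (32)-(33) p.22] -/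
theorem norm_gSer_secondDiff_le {a b a' b' : E} {R : ℝ} (ha : ‖a‖ ≤ R) (hb : ‖b‖ ≤ R) (ha' : ‖a'‖ ≤ R) (hb' : ‖b'‖ ≤ R) :
    ‖(gSer ℂ a - gSer ℂ b) - (gSer ℂ a' - gSer ℂ b')‖
      ≤ Real.exp R * (‖(a - b) - (a' - b')‖ + ‖a' - b'‖ * (‖a - a'‖ + ‖b - b'‖)) := by
  rw [gSer_eq_tsum, gSer_eq_tsum, gSer_eq_tsum, gSer_eq_tsum]
  have h := norm_series_secondDiff_le (E := E) (c := fun n : ℕ => (((n + 1)! : ℂ)⁻¹)) norm_inv_factorial_succ_le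
    (a := -a) (b := -b) (a' := -a') (b' := -b') (R := R)
    (by rwa [norm_neg]) (by rwa [norm_neg]) (by rwa [norm_neg]) (by rwa [norm_neg])
  have e1 : ‖(-a - -b) - (-a' - -b')‖ = ‖(a - b) - (a' - b')‖ := by
    rw [← norm_neg]; congr 1; abel
  have e2 : ‖-a' - -b'‖ = ‖a' - b'‖ := by rw [← norm_neg]; congr 1; abel
  have e3 : ‖-a - -a'‖ = ‖a - a'‖ := by rw [← norm_neg]; congr 1; abel
  have e4 : ‖-b - -b'‖ = ‖b - b'‖ := by rw [← norm_neg]; congr 1; abel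
  rw [e1, e2, e3, e4] at h
  exact h

/-- ★ **`g` IS `e^R`-LIPSCHITZ ON `‖·‖ ≤ R`.** [cite: Balaban1985Averaging, (33) p.22] -/
theorem norm_gSer_sub_gSer_le {a b : E} {R : ℝ} (ha : ‖a‖ ≤ R) (hb : ‖b‖ ≤ R) :
    ‖gSer ℂ a - gSer ℂ b‖ ≤ Real.exp R * ‖a - b‖ := by
  have h := norm_gSer_secondDiff_le ha hb hb hb
  simp only [sub_self, sub_zero, norm_zero, zero_mul, add_zero] at h
  exact h

omit [CompleteSpace E] in
/-- `‖ad X − ad Y‖ ≤ 2‖X − Y‖` (`ad` is linear in `X`). [folklore] -/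
theorem norm_ad_sub_ad_le (X Y : E) : ‖ad ℂ X - ad ℂ Y‖ ≤ 2 * ‖X - Y‖ := by
  have e : ad ℂ X - ad ℂ Y = ad ℂ (X - Y) := by
    ext h
    simp only [ad, Literature.Analysis.Calculus.ExpDifferential.mulL, Literature.Analysis.Calculus.ExpDifferential.mulR,
      sub_apply, ContinuousLinearMap.mul_apply', ContinuousLinearMap.flip_apply]
    noncomm_ring
  rw [e]
  exact norm_ad_le (𝕂 := ℂ) (X - Y)

end Summit.QuantumFields.YangMills.Theorems.Prop7GSerSecondDiff

end
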